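import Summits.BirchSwinnertonDyer.BirchSwinnertonDyer.Theorems.SchneiderFreeAdditiveX3UpperGordCellOfPrintFiveLe
import HarnessLib

/-!
# Route `SchneiderFreeAdditiveX3Upper` (K1 wing), crux r3: at `p ≥ 5` the UPPER half of BSD_p per pair on the (G-ord, `e = 2`) cell rests on
# PUBLISHED facts ∪ {ONE preprint sentence: Keller–Yin's DIVISIBILITY [DIV.dvd]} ∪ {the pair's twist-unit datum}

Cell `bsd-schneider-ideate`, seat `bsd-schneider-door-c5` (prover, generation 23; assembly layer; `--supports` 20365).
PARTITION: board row B6 ∩ X3 ∩ sst-twist, `r = 1`, (G-ord, `e = 2`) half at `p ≥ 5`; types-the-object-of nothing new; SHRINKS the preprint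
input of the per-pair upper half to the divisibility sentence; closes none of B6's cells (BSD NOT advanced).
bears_on: K1-wing (20365 r3, 20364 r2) + K1-door (19177 r3).

WHAT.  Sequel of `…UpperGordCellOfPrintFiveLe` (F4) and `…KYDivisibilityOnly` (F5): there the per-pair upper half at `p ≥ 5` took [DIV]
`thm336_divisibility_branch_OPEN` = torsion ∧ divisibility; but the torsion clause is DERIVED at `p ≥ 5` from CGLS 2022 Prop. 14
(`KYMuZeroOfPrint.isTorsion_muInvariant_eq_zero_empty_of_prop14_of_subSemistableTwist`).  This file re-runs the chain on [DIV.dvd]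
`thm336_dvd_branch_OPEN` (the divisibility "`p^k·L ∈ Char_Λ(𝔛)·R₀⟦T⟧`" at branch frames — Keller–Yin arXiv:2410.23241 Thm. 3.3.6 ∘ Prop. 3.4.4,
second half) alone:
* §1 per datum `span_le_xac_charIdeal_map_of_KY_dvd_of_isTorsion_of_muInvariant_eq_zero` — generation 22's (b) VERBATIM with [DIV] replaced by
  [DIV.dvd] and the torsion of `𝔛` a per-datum hypothesis next to `μ(𝔛) = 0` (the hinge `span_le_charIdeal_map_of_C_pow_mul_mem` needs exactly
  these two).
* §2 the field-local (G-ord, `e = 2`) co-socket at `p ≥ 5` ⇐ PUB {Kolyvagin, modularity, Hsieh A, LZZ, CH signed, CGLS Prop 14} ∧ [DIV.dvd]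
  (F3 §3 VERBATIM with the per-datum torsion + `μ = 0` both from CGLS).
* §3 per pair: `missingUpperBoundAt_gordTwo_fiveLe_of_printedFacts_of_twistUnitAt_of_hsieh_of_lzz_of_KY_dvd_of_prop14_of_castellaHsieh_signed`
  — `MissingUpperBoundAt W p` for every door curve of the (G-ord, `e = 2`) cell at `p ≥ 5` with a twist-unit datum, from PUBLISHED facts ∪
  {[DIV.dvd]} ∪ {TU} (F4's glue `coChainMemberField_gordTwo_of_coIMCFieldAt_of_control`).

HONEST FRAMING: composition of tree theorems, CONDITIONAL on the displayed hypotheses ([DIV.dvd] is an unrefereed preprint claim; CGLS Prop 14 and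
the other named facts are published theorems typed as facts, not proved in the tree; TU is a per-pair certificate, class-wide = wing r2, OPEN);
no item closed; BSD is proved for NO curve; «closes rung: none».

References: Keller–Yin arXiv:2410.23241 Thm. 3.3.6, Prop. 3.4.4 [KellerYin2024b]; Castella–Grossi–Lee–Skinner, Invent. Math. 227 (2022) Prop. 14
[CastellaGrossiLeeSkinner2022]; Castella–Hsieh 2018 §3.3 [CastellaHsieh2018]; Jetchev–Skinner–Wan 2017 §7.4.1; this seat p663835, F4, F5, gen 22 p660338.
-/

set_option autoImplicit false
set_option linter.dupNamespace false -- the summit namespace `…BirchSwinnertonDyer.BirchSwinnertonDyer.Theorems` (Sub = Summit, D-0017) trips it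

noncomputable section

open scoped Classical NumberField

open Field NumberField IsDedekindDomain WeierstrassCurve PowerSeries
  Literature.NumberTheory.EllipticCurves Literature.NumberTheory.EllipticCurves.GreenbergSelmer
  Literature.NumberTheory.GaloisRepresentations Literature.NumberTheory.GaloisCohomology
  Literature.NumberTheory.EllipticCurves.ModularForms Literature.NumberTheory.EllipticCurves.Rank1Residual
  Literature.NumberTheory.EllipticCurves.Rank1Residual.Typed
  Literature.NumberTheory.EllipticCurves.IwasawaAlgebra
  Literature.NumberTheory.EllipticCurves.KellerYin2024 Literature.NumberTheory.EllipticCurves.CaiShuTian2014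
  Summit.BirchSwinnertonDyer.Rank1Residual Summit.BirchSwinnertonDyer.Rank1Residual.X11b
  Summit.BirchSwinnertonDyer.Rank1Residual.X11b.AcSelmer Summit.BirchSwinnertonDyer.Rank1Residual.X11b.Halves
  Summit.BirchSwinnertonDyer.Rank1Residual.X11b.CongruenceLimit
  Summit.BirchSwinnertonDyer.BirchSwinnertonDyer.Theorems
  Summit.BirchSwinnertonDyer.BirchSwinnertonDyer.Theorems.SchneiderFree
  Summit.BirchSwinnertonDyer.BirchSwinnertonDyer.Theorems.SchneiderFree.Upper
  Summit.BirchSwinnertonDyer.BirchSwinnertonDyer.Theorems.SchneiderFree.KYRead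
  Summit.BirchSwinnertonDyer.BirchSwinnertonDyer.Theorems.SchneiderFreeAdditiveX3
  Summit.BirchSwinnertonDyer.BirchSwinnertonDyer.Theorems.SchneiderFreeAdditiveX3.LZZMatch
  Summit.BirchSwinnertonDyer.BirchSwinnertonDyer.Theorems.SchneiderFreeAdditiveX3.ControlDischarged
  Summit.BirchSwinnertonDyer.BirchSwinnertonDyer.Theorems.SchneiderFreeAdditiveX3.KYBranchOnly
  Summit.BirchSwinnertonDyer.BirchSwinnertonDyer.Theorems.SchneiderFreeAdditiveX3.KYBranchHalves
  Summit.BirchSwinnertonDyer.BirchSwinnertonDyer.Theorems.SchneiderFreeAdditiveX3.KYMuZeroOfPrint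
  Summit.BirchSwinnertonDyer.BirchSwinnertonDyer.Theorems.SchneiderFreeAdditiveX3.UpperOfPrint

open Literature.NumberTheory.EllipticCurves.CastellaGrossiLeeSkinner2022 (prop14_residualCharacterSelmer_finite)

-- the wing route's decls, by name (its `PrintedFacts` is the door's, same body)
open Summit.BirchSwinnertonDyer.BirchSwinnertonDyer.Theses.SchneiderFreeAdditiveX3Upper

namespace Summit.BirchSwinnertonDyer.BirchSwinnertonDyer.Theorems.SchneiderFreeAdditiveX3.UpperOfPrintDvd

/-! ### §1 Per datum: `(Q) ⊆ Ch_Λ(𝔛)·𝓞_{ℂ_p}⟦T⟧` from [DIV.dvd] + torsion + `μ(𝔛) = 0` -/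

/-- **(Q) ⊆ Ch_Λ(X_ac^∅)·𝓞_{ℂ_p}⟦T⟧ at every ♭-frame of the conjugate prime, from Keller–Yin's DIVISIBILITY [DIV.dvd] alone plus the per-datum
torsion and `μ = 0` of `𝔛`** — generation 22's `KYBranchHalves.span_le_xac_charIdeal_map_of_KY_divisibility_of_muInvariant_eq_zero` VERBATIM with
`hDIV` replaced by `hdvd : thm336_dvd_branch_OPEN` and the torsion of `𝔛` taken as the hypothesis `hT` (next to `hμX`).  Castella–Hsieh signed frame
at `𝔭′`, [DIV.dvd] at `(𝔭′, 𝔭)` for the presented curve, the hinge `span_le_charIdeal_map_of_C_pow_mul_mem` (slack cancels against the unit coefficient),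
branch-vs-flat rigidity.  CONDITIONAL on the named facts and the displayed per-datum hypotheses; nothing asserted about BSD.
[cite: KellerYin2024b, Thm. 3.3.6 and Prop. 3.4.4, divisibility clause (arXiv:2410.23241 p. 19) (preprint; hypothesis)]
[cite: CastellaHsieh2018, §3.3, Def. 3.7 and Prop. 3.8 (the signed branch frame)] [cite: Washington1997, §7.1 and §13.2] -/
theorem span_le_xac_charIdeal_map_of_KY_dvd_of_isTorsion_of_muInvariant_eq_zero
    (hCHσ : castellaHsieh2018_exists_isBranchBDPLFunction_signed) (hdvd : thm336_dvd_branch_OPEN)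
    (hmodN : exists_isNewformOf)
    -- the prime, the good partner `W′`, the presentation of the door's curve
    {p : ℕ} [hp : Fact p.Prime] (hp2 : p ≠ 2) (W' : WeierstrassCurve ℚ) [W'.IsElliptic]
    (hgood : W'.HasGoodReductionAtPrime p) (D C₂ : VariableChange ℚ)
    [(C₂ • (D • W').quadraticTwist ((-1 : ℚ) ^ (p / 2) * p)).IsElliptic]
    [(C₂ • (D • W').quadraticTwist ((-1 : ℚ) ^ (p / 2) * p)).IsGloballyMinimal] {N : ℕ} [NeZero N]
    (Dt : ModularParametrizationData (C₂ • (D • W').quadraticTwist ((-1 : ℚ) ^ (p / 2) * p)) N)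
    {N' : ℕ} [NeZero N'] (Dt' : ModularParametrizationData W' N') (hpN' : ¬ p ∣ N')
    -- the socket's field, tower, primes, embedding datum; Heegner for `N` and for the partner's level
    {K : Type} [Field K] [NumberField K] [IsGalois ℚ K] (hK : IsImaginaryQuadratic K)
    (hHe : SatisfiesHeegnerHypothesis N K) (hHe' : SatisfiesHeegnerHypothesis N' K)
    (hodd : Odd (NumberField.discr K)) (hdK : NumberField.discr K ≠ -3)
    {κ : ZpExtension K p} (hκ : κ.IsAnticyclotomic) (γ : absoluteGaloisGroup K) [hγ : Fact (κ.IsTopGenerator γ)]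
    {𝔭 : HeightOneSpectrum (𝓞 K)} (h𝔭 : ((p : ℕ) : 𝓞 K) ∈ 𝔭.asIdeal)
    (he : 𝔭.asIdeal.ramificationIdx (𝓞 ℚ) = 1) (hf : 𝔭.asIdeal.inertiaDeg (𝓞 ℚ) = 1)
    {𝔭' : HeightOneSpectrum (𝓞 K)} (h𝔭' : ((p : ℕ) : 𝓞 K) ∈ 𝔭'.asIdeal) (hne : 𝔭 ≠ 𝔭')
    {ι' : PadicAlgCl p ≃+* ℂ} (hι' : BranchInducesPrime p ι' 𝔭')
    -- Keller–Yin's per-curve hypotheses for the presented curve ITSELF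
    (hN : (C₂ • (D • W').quadraticTwist ((-1 : ℚ) ^ (p / 2) * p)).conductorNorm ℤ = N)
    (hcase : (C₂ • (D • W').quadraticTwist ((-1 : ℚ) ^ (p / 2) * p)).HasGoodOrdinaryReductionOverQuadraticAt p)
    (hred : Red (C₂ • (D • W').quadraticTwist ((-1 : ℚ) ^ (p / 2) * p)) p)
    (hlat : ∃ Φ : AddSubgroup (geomTorsion (C₂ • (D • W').quadraticTwist ((-1 : ℚ) ^ (p / 2) * p)) (p : ℤ)),
      IsRationalLine (C₂ • (D • W').quadraticTwist ((-1 : ℚ) ^ (p / 2) * p)) p Φ ∧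
        ¬ LineDecompositionTrivialAt (C₂ • (D • W').quadraticTwist ((-1 : ℚ) ^ (p / 2) * p)) p Φ)
    (htf : ∀ Q : ((C₂ • (D • W').quadraticTwist ((-1 : ℚ) ^ (p / 2) * p)).baseChange K).toAffine.Point,
      p • Q = 0 → Q = 0)
    -- the Greenberg Selmer dual at `(v, v̄) = (𝔭′, 𝔭)` is `Λ`-torsion with `μ = 0` (per-datum hypotheses; derived from print at `p ≥ 5`)
    (hT : Module.IsTorsion (IwasawaAlgebra p) (Literature.NumberTheory.EllipticCurves.Castella2018.AcSelmer.XAc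
      ((C₂ • (D • W').quadraticTwist ((-1 : ℚ) ^ (p / 2) * p)).baseChange K) p κ 𝔭 ∅ γ))
    (hμX : muInvariant p (Literature.NumberTheory.EllipticCurves.Castella2018.AcSelmer.XAc
      ((C₂ • (D • W').quadraticTwist ((-1 : ℚ) ^ (p / 2) * p)).baseChange K) p κ 𝔭 ∅ γ) = 0)
    -- the ♭-frame at the conjugate prime
    {ΩK' : ℂ} {Ωp' : ℂ_[p]} {Q : PowerSeries (PadicComplexInt p)} (hΩK' : ΩK' ≠ 0) (hΩp' : Ωp' ≠ 0)
    (hQ : R1.IsBDPLFunctionInt p ι' 𝔭' κ γ Dt.f ΩK' Ωp' Q) :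
    Ideal.span {Q} ≤ (XAc.charIdeal ((C₂ • (D • W').quadraticTwist ((-1 : ℚ) ^ (p / 2) * p)).baseChange K) p κ 𝔭 ∅ γ).map
        (PowerSeries.map (R1.toCpInt p)) := by
  have hsplit : ((Ideal.span {(p : ℤ)}).primesOver (𝓞 K)).ncard = 2 :=
    ncard_primesOver_eq_two_of_degreeOne hK.1 h𝔭 he hf
  have hcond : ∀ 𝔮 : HeightOneSpectrum (𝓞 K), ((p : ℕ) : 𝓞 K) ∈ 𝔮.asIdeal →
      (KellerYin2024.genusHeckeCharacter K p).HasConductorExponentAt 𝔮 1 := fun 𝔮 h𝔮 ↦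
    KellerYin2024.genusHeckeCharacter_hasConductorExponentAt_one_of_split K p hp2 hK hsplit h𝔮
  -- step 1: the SIGNED branch frame of `(Dt′.f, χ_ε)` at `𝔭′`
  obtain ⟨e, ΩK, Ωp, L, hesign, hΩK, hL⟩ := hCHσ ι' W' K 𝔭' κ γ Dt'.isNewformOf (KellerYin2024.genusHeckeCharacter K p) hp2
    hpN' hK hodd hdK hsplit h𝔭' hι' hHe' hκ hγ.out (KellerYin2024.genusHeckeCharacter_sq K p)
    (fun w hw ↦ KellerYin2024.genusHeckeCharacter_isUnramifiedAt K p hw) hcond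
  have he0 : e ≠ 0 := by rcases hesign with rfl | rfl <;> norm_num
  have hΩp : ((Ωp : unrIntegers p) : ℂ_[p]) ≠ 0 := by
    rw [Ne, ZeroMemClass.coe_eq_zero]
    exact Ωp.ne_zero
  -- step 2: Keller–Yin [DIV.dvd] at `(v, v̄) = (𝔭′, 𝔭)` for the presented curve itself: `p^k·L ∈ Ch·R₀⟦T⟧`;
  -- with `μ(𝔛) = 0` the slack cancels: `(L) ⊆ Ch·R₀⟦T⟧`
  have hS : PotOrdSetting ι' (C₂ • (D • W').quadraticTwist ((-1 : ℚ) ^ (p / 2) * p)) K 𝔭' 𝔭 κ N :=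
    potOrdSetting_of_socketData hp2 ι' _ K 𝔭 𝔭' κ N hN hcase hred hlat htf hK hHe hodd hdK hκ h𝔭 he hf hne hι'
  have htw : ∃ S : Finset ℕ, ∀ ℓ : ℕ, ℓ.Prime → ℓ ∉ S →
      cuspCoeff Dt.f ℓ = ((legendreSym p ℓ : ℤ) : ℂ) * cuspCoeff Dt'.f ℓ :=
    exists_cofinite_cuspCoeff_eq_legendreSym_mul hp2 W' D C₂ Dt Dt'
  have hdiv := hdvd ι' _ K 𝔭' 𝔭 κ γ Dt.isNewformOf hS Dt'.isNewformOf.1 hpN' htw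
  obtain ⟨k, hk⟩ := hdiv e ΩK ((Ωp : unrIntegers p) : ℂ_[p]) L he0 hΩK hΩp hL (toUnr p) (coe_toUnr p)
  haveI : Module.Finite (IwasawaAlgebra p) (Literature.NumberTheory.EllipticCurves.Castella2018.AcSelmer.XAc
      ((C₂ • (D • W').quadraticTwist ((-1 : ℚ) ^ (p / 2) * p)).baseChange K) p κ 𝔭 ∅ γ) :=
    Literature.NumberTheory.EllipticCurves.Castella2018.AcSelmer.XAc.module_finite_empty _ p κ 𝔭 γ
  have h1 : Ideal.span {L} ≤ (XAc.charIdeal ((C₂ • (D • W').quadraticTwist ((-1 : ℚ) ^ (p / 2) * p)).baseChange K)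
      p κ 𝔭 ∅ γ).map (PowerSeries.map (toUnr p)) := by
    rw [xac_charIdeal_eq_literature]
    exact span_le_charIdeal_map_of_C_pow_mul_mem _ hT hμX (toUnr p) (coe_toUnr p) hk
  have h2 := span_le_map_toCpInt_of_span_le_map_toUnr h1
  -- step 3: rigidity — `(Q) ⊆ (L)` since the constant `ι′⁻¹(±1)` is co-integral
  have hKp : Algebra.IsUnramifiedIn (𝓞 K) (Ideal.span {(p : ℤ)}) := isUnramifiedIn_of_splitsTwo hK hsplit
  obtain ⟨c', -, hc'⟩ := exists_coe_eq_symm_of_sign (p := p) (ι := ι') hesign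
  have h4 : Ideal.span {Q} ≤ Ideal.span {PowerSeries.map (R1.unrToCpInt p) L} :=
    span_le_span_map_of_isBranchBDPLFunction_of_isBDPLFunctionInt hp2 hK hKp Dt.f Dt'.f
      (fun _ hℓ hℓp ↦ cuspCoeff_eq_legendreSym_mul_of_presentation hp2 W' D C₂ Dt.isNewformOf Dt'.isNewformOf hℓ hℓp)
      (cuspCoeff_prime_eq_zero_of_presentation hp2 W' hgood D C₂ Dt)
      (prime_dvd_level_of_presentation hmodN hp2 W' hgood D C₂ Dt)
      (fun _ hℓ hℓp ↦ dvd_level_iff_dvd_level_partner_of_presentation hmodN hp2 W' hgood D C₂ Dt Dt' hℓ hℓp)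
      hκ hγ.out hΩK hΩK' hΩp hΩp' hL hQ hc'
  exact h4.trans h2


/-! ### §2 The field-local (G-ord, `e = 2`) co-socket at `p ≥ 5` on PUBLISHED facts ∪ {[DIV.dvd]} -/

/-- **The field-local (G-ord, `e = 2`) co-socket `AdditiveIMCUpperBDPInputManinAtField W p K` at `p ≥ 5` and `d_K ≠ −3` ⇐ Kolyvagin ∧ modularity ∧
Hsieh 2014 Thm. A ∧ LZZ 2018 ∧ Castella–Hsieh signed existence ∧ CGLS 2022 Prop. 14 (ALL PUBLISHED) ∧ [DIV.dvd] (Keller–Yin's divisibility sentence,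
PREPRINT).**  F3's `KYMuZeroOfPrint.additiveIMCUpperBDPInputManinAtField_of_hsieh_of_lzz_of_KY_divisibility_of_prop14_of_castellaHsieh_signed` VERBATIM
with §1 in place of generation 22's (b): torsion AND `μ = 0` of `𝔛` at the presented curve both from CGLS Prop. 14 + the local non-anomalous clause
(`isTorsion_muInvariant_eq_zero_empty_of_prop14_of_subSemistableTwist`).  CONDITIONAL; nothing asserted about BSD.
[cite: CastellaGrossiLeeSkinner2022, §1.2 Prop. 14 (arXiv:2008.02571; Invent. Math. 227 (2022))]
[cite: KellerYin2024b, Thm. 3.3.6 and Prop. 3.4.4, divisibility clause (arXiv:2410.23241 p. 19) (preprint; hypothesis)]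
[cite: CastellaHsieh2018, §3.3, Def. 3.7 and Prop. 3.8] [cite: Hsieh2014, Thm. A p. 712 (Doc. Math. 19)]
[cite: LiuZhangZhang2018, Thm 1.5.1 and Thm 1.5.3 (Duke Math. J. 167 pp. 748–749)] [cite: AtkinLehner1970, Thm. 4] -/
theorem additiveIMCUpperBDPInputManinAtField_of_hsieh_of_lzz_of_KY_dvd_of_prop14_of_castellaHsieh_signed
    (hKo : ∀ (N : ℕ) [NeZero N] (W : WeierstrassCurve ℚ) (K : Type) [Field K] [NumberField K],
      Literature.NumberTheory.EllipticCurves.kolyvagin N W K)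
    (hPar : nonempty_modularParametrizationData)
    (hA : Hsieh2014.thmA_exists_isHsiehLFunction_unrPeriod_anyLevel)
    (hL : LiuZhangZhang2018.thm151_thm153_modularCurve_heegnerVector_additive)
    (hdvd : thm336_dvd_branch_OPEN) (h14 : prop14_residualCharacterSelmer_finite)
    (hCHσ : castellaHsieh2018_exists_isBranchBDPLFunction_signed)
    {W : WeierstrassCurve ℚ} [W.IsElliptic] [W.IsGloballyMinimal] {p : ℕ} [Fact p.Prime]
    (hp5 : 5 ≤ p) (hX : ClassX3 W p) (hSG : Additive.SubGordTwo W p)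
    (hlat : ∃ Φ : AddSubgroup (geomTorsion W (p : ℤ)), IsRationalLine W p Φ ∧ ¬ LineDecompositionTrivialAt W p Φ)
    (K : Type) [Field K] [NumberField K] (hdK : NumberField.discr K ≠ -3) :
    AdditiveIMCUpperBDPInputManinAtField W p K := by
  have hp : p.Prime := Fact.out
  have hp2 : p ≠ 2 := by omega
  have hcase : W.HasGoodOrdinaryReductionOverQuadraticAt p :=
    hasGoodOrdinaryReductionOverQuadraticAt_of_subGordTwo hp2 W hX hSG
  obtain ⟨Φ₀, hΦ₀, -⟩ := id hlat
  have hred : Red W p := red_of_isRationalLine hΦ₀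
  obtain ⟨W', hE', hmin', C₂, hW, hord, hΔ⟩ :=
    exists_goodOrd_partner_presentation_of_subGordTwo_odd hp2 W hX hSG
  subst hW
  haveI : NeZero (W'.conductorNorm ℤ) := ⟨(WeierstrassCurve.conductorNorm_pos_holds W').ne'⟩
  intro N _ Dt H ι P hr' hloc hN hK hodd hunit hHe hL1 hP hnt htf κ hκ γ _ 𝔭 h𝔭 he hf
  refine additiveIMCUpperBDPOnTreeLeAt_of_kolyvagin_of_hsieh_of_lzz_of_intCoDivConj hKo hA hL hp2 hX (Or.inr hSG) Dt H ι P
    hr' hloc hN hK hodd hunit hHe hL1 hP hnt κ hκ γ 𝔭 h𝔭 he hf ?_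
  intro 𝔮 h𝔮 hne he' hf' ι' hι' ΩK Ωp Q hΩK hΩp hQ
  obtain ⟨Dt'⟩ := hPar W'
  haveI : IsGalois ℚ K := Literature.FieldTheory.Galois.isGalois_of_finrank_eq_two hK.1
  have hpN' : ¬ p ∣ W'.conductorNorm ℤ := not_dvd_conductorNorm_of_hasGoodReductionAtPrime W' hord.1
  have hmodN : exists_isNewformOf := exists_isNewformOf_of_nonempty_modularParametrizationData hPar
  have hHe' : SatisfiesHeegnerHypothesis (W'.conductorNorm ℤ) K :=
    SatisfiesHeegnerHypothesis.of_dvd (conductorNorm_partner_dvd_level hmodN hp2 W' hord.1 _ C₂ Dt) hHe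
  -- torsion AND `μ(𝔛) = 0` at `v̄ = 𝔭` for the presented curve itself, FROM PRINT (CGLS Prop. 14 + the local clause at `p ≥ 5`)
  have hsplit : ((Ideal.span {(p : ℤ)}).primesOver (𝓞 K)).ncard = 2 :=
    ncard_primesOver_eq_two_of_degreeOne hK.1 h𝔭 he hf
  obtain ⟨hT, hμX⟩ := isTorsion_muInvariant_eq_zero_empty_of_prop14_of_subSemistableTwist h14 _ K 𝔭 κ γ hp5 hX (Or.inr hSG)
    hK (by rw [hN]; exact hHe) hsplit h𝔭 hκ
  exact span_le_xac_charIdeal_map_of_KY_dvd_of_isTorsion_of_muInvariant_eq_zero hCHσ hdvd hmodN hp2 W' hord.1 _ C₂ Dt Dt' hpN'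
    hK hHe hHe' hodd hdK hκ γ h𝔭 he hf h𝔮 hne hι' hN hcase hred hlat htf hT hμX hΩK hΩp hQ

/-! ### §3 Per pair: the UPPER half on (G-ord, `e = 2`) at `p ≥ 5` from PUBLISHED facts ∪ {[DIV.dvd]} ∪ {TU} -/

/-- **UPPER half per pair on the (G-ord, `e = 2`) cell at `p ≥ 5` ⇐ `PrintedFacts` ∧ Hsieh 2014 Thm. A ∧ Liu–Zhang–Zhang 2018 ∧ CGLS 2022 Prop. 14 ∧
Castella–Hsieh signed existence (ALL PUBLISHED) ∧ [DIV.dvd] (Keller–Yin 2410.23241 Thm 3.3.6 ∘ Prop 3.4.4, the DIVISIBILITY sentence — the ONE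
unrefereed input) ∧ the pair's twist-unit datum.**  For every globally minimal `W/ℚ` with `r_an = 1`, `p ≥ 5`, `ClassX3 W p`, `SubGordTwo W p`,
`Upper.TwistUnitFieldOffSliverAt W p`: `MissingUpperBoundAt W p` (`ord_p #Ш(E) ≤ ord_p #Ш(E)_an`).  F4's glue with §2 as the co-socket and the
CLOSED control corner.  CONDITIONAL; closes no item; BSD not advanced.
[cite: CastellaGrossiLeeSkinner2022, §1.2 Prop. 14 (arXiv:2008.02571; Invent. Math. 227 (2022))]
[cite: KellerYin2024b, Thm. 3.3.6 and Prop. 3.4.4, divisibility clause (arXiv:2410.23241 p. 19) (preprint; hypothesis)]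
[cite: JetchevSkinnerWan2017, §7.4.1 (arXiv:1512.06894 p. 30)] [cite: CastellaHsieh2018, §3.3, Def. 3.7 and Prop. 3.8] [cite: Miller2011LMS, Def. 1.1] -/
theorem missingUpperBoundAt_gordTwo_fiveLe_of_printedFacts_of_twistUnitAt_of_hsieh_of_lzz_of_KY_dvd_of_prop14_of_castellaHsieh_signed
    (hF : PrintedFacts) (hA : Hsieh2014.thmA_exists_isHsiehLFunction_unrPeriod_anyLevel)
    (hL : LiuZhangZhang2018.thm151_thm153_modularCurve_heegnerVector_additive)
    (hdvd : thm336_dvd_branch_OPEN) (h14 : prop14_residualCharacterSelmer_finite)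
    (hCHσ : castellaHsieh2018_exists_isBranchBDPLFunction_signed) :
    ∀ (W : WeierstrassCurve ℚ) [W.IsElliptic] [W.IsGloballyMinimal] (p : ℕ) [Fact p.Prime],
      5 ≤ p → W.analyticRank = 1 → ClassX3 W p → Additive.SubGordTwo W p → Upper.TwistUnitFieldOffSliverAt W p →
      MissingUpperBoundAt W p := by
  obtain ⟨hGZ, hKo, hGZK, hmod, hPar, hCas, hGZ73, -, -, hHP, -, -, -⟩ := hF
  have hCtl := anticycControlAdditiveKF_proof controlFacts_proof.1 controlFacts_proof.2.1 controlFacts_proof.2.2.1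
    controlFacts_proof.2.2.2 hKo
  intro W _ _ p _ hp5 hr hX hG hTU
  have hp2 : p ≠ 2 := by omega
  have hpN : p ∣ W.conductorNorm ℤ := (W.dvd_conductorNorm_iff_not_hasGoodReductionAtPrime p).mpr hX.2.1
  exact Upper.missingUpperBoundAt_of_goodMemberCoStepLField_of_twistUnitFieldOffSliver hGZ hKo hGZK hmod hGZ73 hCas hHP W p hr hp2
    hpN (fun K _ _ hK _ hpd hdK ↦ coChainMemberField_gordTwo_of_coIMCFieldAt_of_control hKo hPar hCtl W p hr hp2 hX hG K hK hpd
      fun W₁ _ _ hX₁ hS₁ hlat₁ ↦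
        additiveIMCUpperBDPInputManinAtField_of_hsieh_of_lzz_of_KY_dvd_of_prop14_of_castellaHsieh_signed hKo hPar hA hL
          hdvd h14 hCHσ hp5 hX₁ hS₁ hlat₁ K hdK) hTU

end Summit.BirchSwinnertonDyer.BirchSwinnertonDyer.Theorems.SchneiderFreeAdditiveX3.UpperOfPrintDvd

end
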